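import Mathlib
import Summits.Ventures.PercRepro.TriangleCapDeepThree

/-!
# PercRepro — THE BOTTOM OF EVERY SUB-BAND ON `4 + (s − t)` VERTICES, AND THE DEEP SUB-BAND AS A FINSET
(p3, gen 54; part 286)

On `4 + (s − t)` vertices the sub-band `u` (maximum off-degree exactly `t − u`) has bottom

  **`(t − u − 1) · max(u, 3 u − t)`**   (`subband_bottom_three`)

— the shallow bottom `B(u) = u (t − u − 1)` of §10df(b) for `2 u ≤ t` (the `K_{2,u}` through the centre, here the
deep witness family with `c₂ = u`, `c₃ = 0`, `β = u` pair rows) and the deep bottom `(t − u − 1)(3 u − t)` of part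
281 for `2 u > t` (the nested configuration `(D, D, t − 2 D)` with `r = t − 2 D` full rows and `3 D − t` pair rows):
the bound one way, the witness the other.  THE DEEP SUB-BAND AS A FINSET (`deepSubBandThree`): the interval from
the bottom to `deepTop t 2 u / 2` with the value `bottom + 1` erased when `3 u = 2 t`; membership is the graph
condition of part 284 (`mem_deepSubBandThree_iff`) and the size is `top − bottom + 1 − [3 u = 2 t]`
(`card_deepSubBandThree`).  Axioms: standard.
-/

namespace PercRepro

namespace TriangleCap

namespace C047

open Finset

/-- The band value of the bottom witness of the deep sub-band: with `D = t − u`, `r = u − D`,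
`t (t − 1) − (2 D (D − 1) + r (r − 1) + 6 r + 2 (D − r)) = 2 (D − 1)(D + 2 r)`. -/
theorem deep_bottom_value (D r : ℕ) (hD : 1 ≤ D) (hr : 1 ≤ r) (hrD : r ≤ D) :
    (2 * D + r) * (2 * D + r - 1) -
      (D * (D - 1) + D * (D - 1) + r * (r - 1) + 6 * r + 2 * (D - r)) = 2 * ((D - 1) * (D + 2 * r)) := by
  have h := deep_three_poly D r hD hr
  have e : D * (D - 1) + D * (D - 1) + r * (r - 1) + 6 * r + 2 * (D - r) =
      2 * (D * (D - 1)) + r * (r - 1) + 4 * r + 2 * D := by omega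
  rw [e]
  omega

/-- **THE BOTTOM OF EVERY SUB-BAND ON `4 + (s − t)` VERTICES:** for `1 ≤ u`, `3 u ≤ 2 t`, `u + 3 ≤ t`, `2 t ≤ s`,
every graph of the sub-band `u` (maximum off-degree exactly `t − u`) has `j ≥ (t − u − 1) · max(u, 3 u − t)`, and
this value is attained in the sub-band. -/
theorem subband_bottom_three (s t u : ℕ) (hu : 1 ≤ u) (hu2 : 3 * u ≤ 2 * t) (hD : u + 3 ≤ t) (hs : 2 * t ≤ s) :
    (∀ (H : SimpleGraph (Fin (3 + 1 + (s - t)))) [DecidableRel H.Adj], H.CliqueFree 3 →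
      H.edgeFinset.card = s → ∀ w, deg H w + t = s → (∀ v, offDeg H w v + u ≤ t) → (∃ x, offDeg H w x + u = t) →
      ∀ j, ∑ v, deg H v * deg H v + 2 * (t * (s - t - 1)) + 2 * j = s * (s + 1) →
      (t - u - 1) * max u (3 * u - t) ≤ j) ∧
    (∃ (H : SimpleGraph (Fin (3 + 1 + (s - t)))) (_ : DecidableRel H.Adj), H.CliqueFree 3 ∧
      H.edgeFinset.card = s ∧ ∃ w, deg H w + t = s ∧ (∀ v, offDeg H w v + u ≤ t) ∧
        (∃ x, offDeg H w x + u = t) ∧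
        ∑ v, deg H v * deg H v + 2 * (t * (s - t - 1)) + 2 * ((t - u - 1) * max u (3 * u - t)) = s * (s + 1)) := by
  rcases Nat.lt_or_ge t (2 * u) with hdeep | hshallow
  · -- the deep regime: part 284
    have hmax : max u (3 * u - t) = 3 * u - t := max_eq_right (by omega)
    rw [hmax]
    constructor
    · intro H _ hfree hsH w hw hmx ⟨x, hx⟩ j hj
      exact ((deep_subband_three s t u j (by omega) hu2 hD hs).mp ⟨H, inferInstance, hfree, hsH, w, hw, hmx, ⟨x, hx⟩, hj⟩).1
    · -- the nested witness `(D, D, r)`, `r` full rows, `D − r` pair rows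
      obtain ⟨D, hDdef⟩ : ∃ D, D = t - u := ⟨_, rfl⟩
      obtain ⟨r, hr⟩ : ∃ r, u = D + r := ⟨u - D, by omega⟩
      have hD3 : 3 ≤ D := by omega
      have hr1 : 1 ≤ r := by omega
      have hrD : r ≤ D := by omega
      obtain ⟨H, inst, hfree, hsH, w, hw, hmx, ⟨x, hxw, hx⟩, hjH⟩ :=
        deepThreeWitness s t D D r r (D - r) hD3 le_rfl hrD (by omega) le_rfl (by omega) hs
      refine ⟨H, inst, hfree, hsH, w, hw, fun v => ?_, ⟨x, ?_⟩, ?_⟩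
      · have := hmx v
        omega
      · omega
      · have hval := deep_bottom_value D r (by omega) hr1 hrD
        have e1 : t = 2 * D + r := by omega
        have e2 : t - u - 1 = D - 1 := by omega
        have e3 : 3 * u - t = D + 2 * r := by omega
        rw [e2, e3, ← hval, ← e1]
        exact hjH
  · -- the shallow regime: `K_{2,u}`, part 252's bound
    have hmax : max u (3 * u - t) = u := max_eq_left (by omega)
    rw [hmax]
    constructor
    · intro H _ hfree hsH w hw _ ⟨x, hx⟩ j hj
      rw [mul_comm]
      exact subband_lower_bound' H hfree s t u j hsH w (by omega) hw hj x hx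
    · obtain ⟨H, inst, hfree, hsH, w, hw, hmx, ⟨x, hxw, hx⟩, hjH⟩ :=
        deepThreeWitness s t (t - u) u 0 0 u (by omega) (by omega) (by omega) (by omega) le_rfl (by omega) hs
      refine ⟨H, inst, hfree, hsH, w, hw, fun v => ?_, ⟨x, ?_⟩, ?_⟩
      · have := hmx v
        omega
      · omega
      · have hid := subband_identity t u (by omega)
        have e : t * (t - 1) - ((t - u) * (t - u - 1) + u * (u - 1) + 0 * (0 - 1) + 6 * 0 + 2 * u) =
            2 * (u * (t - u - 1)) := by
          have h1 : u * (u + 1) = u * (u - 1) + 2 * u := by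
            obtain ⟨u', rfl⟩ : ∃ u', u = u' + 1 := ⟨u - 1, by omega⟩
            rw [Nat.add_sub_cancel]
            ring
          omega
        rw [e, mul_comm u] at hjH
        exact hjH

/-- The deep sub-band `u` on `4 + (s − t)` vertices as a finset: the interval from `(t − u − 1)(3 u − t)` to
`deepTop t 2 u / 2`, with `bottom + 1` erased when `3 u = 2 t`. -/
def deepSubBandThree (t u : ℕ) : Finset ℕ :=
  if 3 * u = 2 * t then (Icc ((t - u - 1) * (3 * u - t)) (deepTop t 2 u / 2)).erase ((t - u - 1) * (3 * u - t) + 1)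
  else Icc ((t - u - 1) * (3 * u - t)) (deepTop t 2 u / 2)

/-- Membership in `deepSubBandThree`. -/
theorem mem_deepSubBandThree (t u j : ℕ) :
    j ∈ deepSubBandThree t u ↔
      ((t - u - 1) * (3 * u - t) ≤ j ∧ 2 * j ≤ deepTop t 2 u ∧
        (3 * u = 2 * t → j ≠ (t - u - 1) * (3 * u - t) + 1)) := by
  unfold deepSubBandThree
  have h2 : j ≤ deepTop t 2 u / 2 ↔ 2 * j ≤ deepTop t 2 u := by
    rw [Nat.le_div_iff_mul_le (by norm_num), mul_comm]
  split_ifs with h3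
  · rw [mem_erase, mem_Icc, h2]
    constructor
    · rintro ⟨hne, h1, h2'⟩
      exact ⟨h1, h2', fun _ => hne⟩
    · rintro ⟨h1, h2', hne⟩
      exact ⟨hne h3, h1, h2'⟩
  · rw [mem_Icc, h2]
    constructor
    · rintro ⟨h1, h2'⟩
      exact ⟨h1, h2', fun h => absurd h h3⟩
    · rintro ⟨h1, h2', -⟩
      exact ⟨h1, h2'⟩

/-- **THE DEEP SUB-BAND AS A FINSET:** for `t + 1 ≤ 2 u`, `3 u ≤ 2 t`, `u + 3 ≤ t`, `2 t ≤ s`, `j` is the band value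
of a graph of the sub-band `u` on `4 + (s − t)` vertices iff `j ∈ deepSubBandThree t u`. -/
theorem mem_deepSubBandThree_iff (s t u j : ℕ) (hu : t + 1 ≤ 2 * u) (hu2 : 3 * u ≤ 2 * t) (hD : u + 3 ≤ t)
    (hs : 2 * t ≤ s) :
    (∃ (H : SimpleGraph (Fin (3 + 1 + (s - t)))) (_ : DecidableRel H.Adj), H.CliqueFree 3 ∧
      H.edgeFinset.card = s ∧ ∃ w, deg H w + t = s ∧ (∀ v, offDeg H w v + u ≤ t) ∧
        (∃ x, offDeg H w x + u = t) ∧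
        ∑ v, deg H v * deg H v + 2 * (t * (s - t - 1)) + 2 * j = s * (s + 1)) ↔ j ∈ deepSubBandThree t u := by
  rw [mem_deepSubBandThree]
  exact deep_subband_three s t u j hu hu2 hD hs

/-- The bottom of the deep sub-band lies below its top: `2 (t − u − 1)(3 u − t) + 2 ≤ deepTop t 2 u` whenever the
sub-band has two values, and `2 (t − u − 1)(3 u − t) ≤ deepTop t 2 u` always (`t + 1 ≤ 2 u`, `3 u ≤ 2 t`, `u + 3 ≤ t`). -/
theorem deep_bottom_le_top (t u : ℕ) (hu : t + 1 ≤ 2 * u) (hu2 : 3 * u ≤ 2 * t) (hD : u + 3 ≤ t) :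
    2 * ((t - u - 1) * (3 * u - t)) ≤ deepTop t 2 u := by
  have h := ((subband_bottom_three (2 * t) t u (by omega) hu2 hD le_rfl).2)
  have hmax : max u (3 * u - t) = 3 * u - t := max_eq_right (by omega)
  rw [hmax] at h
  obtain ⟨H, inst, hfree, hsH, w, hw, hmx, hx, hj⟩ := h
  exact ((deep_subband_three (2 * t) t u _ hu hu2 hD le_rfl).mp ⟨H, inst, hfree, hsH, w, hw, hmx, hx, hj⟩).2.1

/-- The top of the regular deep sub-band `t = 3 D`, `u = 2 D`: `deepTop (3 D) 2 (2 D) = 6 D²`. -/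
theorem deepTop_regular (D : ℕ) (hD : 1 ≤ D) : deepTop (3 * D) 2 (2 * D) = 6 * (D * D) := by
  unfold deepTop
  rw [coll_lfRR_zero 2 (2 * D) (by norm_num), Nat.mul_div_cancel_left D (by norm_num), Nat.mul_mod_right,
    zero_mul, mul_zero, add_zero]
  obtain ⟨D', rfl⟩ : ∃ D', D = D' + 1 := ⟨D - 1, by omega⟩
  have e1 : 3 * (D' + 1) - 2 * (D' + 1) - 1 = D' := by omega
  have e2 : D' + 1 - 1 = D' := by omega
  have e3 : 2 * (D' + 1) * (2 * (D' + 1) + 1) = 2 * (D' * (D' + 1)) + 2 * (D' + 1) * (D' + 3) := by ring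
  rw [e1, e2, e3, mul_comm D' (D' + 1), Nat.add_sub_cancel_left]
  ring

/-- **THE SIZE OF THE DEEP SUB-BAND:** `deepTop t 2 u / 2 + 1 − (t − u − 1)(3 u − t) − [3 u = 2 t]`. -/
theorem card_deepSubBandThree (t u : ℕ) (hu : t + 1 ≤ 2 * u) (hu2 : 3 * u ≤ 2 * t) (hD : u + 3 ≤ t) :
    (deepSubBandThree t u).card =
      deepTop t 2 u / 2 + 1 - (t - u - 1) * (3 * u - t) - (if 3 * u = 2 * t then 1 else 0) := by
  have hle := deep_bottom_le_top t u hu hu2 hD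
  have hle' : (t - u - 1) * (3 * u - t) ≤ deepTop t 2 u / 2 := by omega
  unfold deepSubBandThree
  split_ifs with h3
  · rw [card_erase_of_mem, Nat.card_Icc]
    rw [mem_Icc]
    refine ⟨by omega, ?_⟩
    -- `t = 3 D`, `u = 2 D`: the top is `3 D²`, the bottom `3 D (D − 1)`
    obtain ⟨D, hDdef⟩ : ∃ D, D = t - u := ⟨_, rfl⟩
    have ht : t = 3 * D := by omega
    have hu' : u = 2 * D := by omega
    subst ht hu'
    rw [deepTop_regular D (by omega)]
    have e1 : 3 * D - 2 * D - 1 = D - 1 := by omega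
    have e2 : 3 * (2 * D) - 3 * D = 3 * D := by omega
    rw [e1, e2]
    obtain ⟨D', rfl⟩ : ∃ D', D = D' + 1 := ⟨D - 1, by omega⟩
    have e3 : D' + 1 - 1 = D' := by omega
    rw [e3]
    have e4 : 6 * ((D' + 1) * (D' + 1)) / 2 = 3 * ((D' + 1) * (D' + 1)) := by omega
    rw [e4]
    nlinarith
  · rw [Nat.card_Icc, Nat.sub_zero]

end C047

end TriangleCap

end PercRepro
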